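import Literature.Combinatorics.Optimization.DualConeBlockPsdLifts
import Literature.Combinatorics.Optimization.CopositivePsdPlusNonnegative
import Literature.Combinatorics.Optimization.MinPsdRankGeometry
import Literature.LinearAlgebra.Matrix.SymmetricMatrixCongruence
import Mathlib.Algebra.Order.Chebyshev
import HarnessLib

/-!
# `sxd(CP_k) = sxd(CP_k^*)`: the copositive and the completely positive cone have `(S^d_+)^r`-lifts
# simultaneously (Averkov 2019, Cor. 16, first clause — every `k`)

G. Averkov, *Optimal size of linear matrix inequalities in semidefinite approaches to polynomial
optimization*, SIAM J. Appl. Algebra Geom. **3** (2019) = arXiv:1806.08656 [cite: Averkov2019] (held text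
`paper:arxiv-1806.08656`; `pNN` = page of that text). Everything here is PROVED; no facts are asserted.

**Corollary 16 (p06)**: "One has `sxd(CP_k) = sxd(CP_k^*) ≥ k`, and the equality `sxd(CP_k) = sxd(CP_k^*) = k`
holds if `k ≤ 4`", for `CP_k = {A ∈ S^k : xᵀAx ≥ 0 ∀ x ∈ ℝ^k_+}` (copositive) and its dual `CP_k^*` (completely
positive, "the closed convex cone generated by … `xxᵀ` with `x ∈ ℝ^k_+`"). The tree already has the lower bound
`≥ k` for both cones (`not_hasBlockPsdLift_copositiveCone`, `not_hasBlockPsdLift_completelyPositiveCone`) and the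
exact value `k` for `k ≤ 4` (`isLeast_blockSize_hasBlockPsdLift_copositiveCone_of_le_four`,
`isLeast_blockSize_hasBlockPsdLift_completelyPositiveCone_of_le_four`). **This file proves the first clause,
`sxd(CP_k) = sxd(CP_k^*)` for every `k`** — the one piece of Cor. 16 that was missing ("the exact values
`sxd(CP_k)` for `k > 4` are left undetermined. In fact, it is not even known if these values are finite", p06;
by the present file the two finiteness questions are one question, `exists_hasBlockPsdLift_copositiveCone_iff`).

Proof as printed: Cor. 16's first equality is the instance `C = CP_k ⊆ S^k` of (2.2) "`sxd(C) = sxd(C^*)`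
… if `C ⊆ ℝ^n` is an `n`-dimensional pointed closed convex cone" (p06, from [GPT:2013] via Thm. 19 /
Remark 21, p08). The tree's `hasBlockPsdLift_dualCone_iff` (`DualConeBlockPsdLifts.lean`) is (2.1)/(2.2) for
pointed full-dimensional closed convex cones of a coordinate space `ℝ^V` with the dot product. We transport
`CP_k ⊆ S^k` to `ℝ^{C(k+1,2)}` by the tree's inner-product preserving coordinates of `S^k`
(`MinPsdRankGeometry.lean`: `SymIdx k`, `symOfVec`, `vecOfSym`, `trace_mul_eq_dotProduct_vecOfSym` — the
basis `E_ii`, `(E_ij + E_ji)/√2` of Gouveia–Robinson–Thomas), check that the image `copVec k` is closed, convex,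
pointed (by `I + J`: `tr A + 𝟙ᵀA𝟙 = 0` forces a copositive `A` to vanish) and full-dimensional (`I` is
interior: `xᵀ(I + E)x ≥ (1 - kε)‖x‖²` for `|E_ij| ≤ ε`, `x ≥ 0`), and identify its dual with the coordinates
of `CP_k^*` through the tree's trace duality `CP_k^* = (CP_k)^*`
(`mem_completelyPositiveCone_iff_forall_copositiveCone`, `CopositivePsdPlusNonnegative.lean`).

Conventions. The tree's `copositiveCone k` (`CopositiveConeExtensionDegree.lean`) does not impose symmetry;
Averkov's `CP_k ⊆ S^k` is `symCopositiveCone k := copositiveCone k ∩ {A : Aᵀ = A}` (the tree's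
`symmetricSubmodule`). For the symmetric cone the transfer keeps `d` AND `r`
(`hasBlockPsdLift_symCopositiveCone_iff`: `(S^d_+)^r`-lift of `CP_k` iff one of `CP_k^*`, so also
`sxc(CP_k) = sxc(CP_k^*)`, (2.1)); for the tree's non-symmetric cone,
`copositiveCone k = symCopositiveCone k + N` with `N = symNonnegCone k ⊇` the skew matrices costs `2k` extra
blocks of size `k ≤ d` on the way back (`HasBlockPsdLift.copositiveCone_of_completelyPositiveCone`), which does
not affect `sxd`: `setOf_blockSize_copositiveCone_eq` and `Averkov2019_cor16_sxd`.
-/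

noncomputable section

open Finset Matrix
open scoped Pointwise

namespace Literature.Combinatorics.Optimization

open Literature.Combinatorics.Optimization.MotzkinStrausCopositive (IsCopositive)
open Literature.LinearAlgebra.Matrix (symmetricSubmodule mem_symmetricSubmodule)

/-- **Averkov's `CP_k ⊆ S^k`**: the SYMMETRIC copositive `k × k` matrices, `{A ∈ S^k : xᵀAx ≥ 0 ∀ x ∈ ℝ^k_+}`
— the tree's `copositiveCone k` (no symmetry imposed) cut by the tree's `symmetricSubmodule`.
[cite: Averkov2019, §2.1 (p06, "`CP_k := {A ∈ S^k : …}`")] -/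
def symCopositiveCone (k : ℕ) : Set (Matrix (Fin k) (Fin k) ℝ) :=
  copositiveCone k ∩ (symmetricSubmodule (Fin k) ℝ : Set (Matrix (Fin k) (Fin k) ℝ))

/-- Membership in `CP_k ⊆ S^k`. [cite: Averkov2019, §2.1 (p06)] -/
theorem mem_symCopositiveCone_iff {k : ℕ} {A : Matrix (Fin k) (Fin k) ℝ} :
    A ∈ symCopositiveCone k ↔ IsCopositive A ∧ Aᵀ = A := Iff.rfl

namespace CopositiveDual

variable {k : ℕ}

/-! ### §1 Quadratic forms: symmetrisation and the test vectors `e_i`, `e_i + e_j`, `𝟙` -/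

/-- `xᵀAᵀx = xᵀAx`. [folklore] -/
private theorem qf_transpose (A : Matrix (Fin k) (Fin k) ℝ) (x : Fin k → ℝ) : x ⬝ᵥ Aᵀ *ᵥ x = x ⬝ᵥ A *ᵥ x := by
  rw [mulVec_transpose, dotProduct_mulVec]
  exact dotProduct_comm _ _

/-- `A + Aᵀ` is copositive when `A` is. [cite: Averkov2019, §2.1 (p06, `CP_k ⊆ S^k`)] -/
theorem isCopositive_add_transpose {A : Matrix (Fin k) (Fin k) ℝ} (hA : IsCopositive A) :
    IsCopositive (A + Aᵀ) := fun x hx => by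
  rw [add_mulVec, dotProduct_add, qf_transpose]
  exact add_nonneg (hA x hx) (hA x hx)

/-- `e_i ≥ 0`. [folklore] -/
private theorem single_nonneg (i : Fin k) : ∀ l, 0 ≤ (Pi.single i (1 : ℝ) : Fin k → ℝ) l := fun l => by
  rw [Pi.single_apply]
  split_ifs <;> norm_num

/-- `e_iᵀ A e_i = A_ii`. [folklore] -/
private theorem qf_single (A : Matrix (Fin k) (Fin k) ℝ) (i : Fin k) :
    Pi.single i (1 : ℝ) ⬝ᵥ A *ᵥ Pi.single i 1 = A i i := by
  rw [mulVec_single_one, single_dotProduct, one_mul]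
  rfl

/-- `(e_i + e_j)ᵀ A (e_i + e_j) = A_ii + A_ij + A_ji + A_jj`. [folklore] -/
private theorem qf_single_add_single (A : Matrix (Fin k) (Fin k) ℝ) (i j : Fin k) :
    (Pi.single i (1 : ℝ) + Pi.single j 1) ⬝ᵥ A *ᵥ (Pi.single i 1 + Pi.single j 1) =
      A i i + A i j + A j i + A j j := by
  simp only [mulVec_add, add_dotProduct, dotProduct_add, mulVec_single_one, single_dotProduct, one_mul,
    col_apply]
  ring

/-- `𝟙ᵀ A 𝟙 = Σ_{ij} A_ij`. [folklore] -/
private theorem qf_ones (A : Matrix (Fin k) (Fin k) ℝ) :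
    (fun _ => (1 : ℝ)) ⬝ᵥ A *ᵥ (fun _ => (1 : ℝ)) = ∑ i, ∑ j, A i j := by
  simp [dotProduct, mulVec]

/-- Diagonal entries of a copositive matrix are `≥ 0` (`x = e_i`). [cite: Averkov2019, §2.1 (p06)] -/
theorem diag_nonneg_of_isCopositive {A : Matrix (Fin k) (Fin k) ℝ} (hA : IsCopositive A) (i : Fin k) :
    0 ≤ A i i := by
  rw [← qf_single A i]
  exact hA _ (single_nonneg i)

/-- Off-diagonal entries of a symmetric copositive matrix with zero diagonal are `≥ 0` (`x = e_i + e_j`).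
[cite: Averkov2019, §2.1 (p06)] -/
theorem offdiag_nonneg_of_isCopositive {A : Matrix (Fin k) (Fin k) ℝ} (hA : IsCopositive A) (hAt : Aᵀ = A)
    {i j : Fin k} (hi : A i i = 0) (hj : A j j = 0) : 0 ≤ A i j := by
  have h := hA (Pi.single i 1 + Pi.single j 1) (fun l => add_nonneg (single_nonneg i l) (single_nonneg j l))
  rw [qf_single_add_single, hi, hj] at h
  have hs : A j i = A i j := by
    have h1 := congrFun (congrFun hAt i) j
    exact h1
  linarith

/-- The coordinate pairing is the trace pairing: `Σ_{ij} A_ij X_ij = tr(A X)` for symmetric `X`. [folklore] -/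
private theorem sum_sum_mul_eq_trace {A X : Matrix (Fin k) (Fin k) ℝ} (hX : Xᵀ = X) :
    ∑ i, ∑ j, A i j * X i j = (A * X).trace := by
  simp only [trace, diag_apply, mul_apply]
  refine sum_congr rfl fun i _ => sum_congr rfl fun j _ => ?_
  rw [show X j i = X i j from congrFun (congrFun hX i) j]

/-- `tr(Aᵀ X) = tr(A X)` for symmetric `X`. [folklore] -/
private theorem trace_transpose_mul_of_symm (A : Matrix (Fin k) (Fin k) ℝ) {X : Matrix (Fin k) (Fin k) ℝ}
    (hX : Xᵀ = X) : (Aᵀ * X).trace = (A * X).trace := by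
  calc (Aᵀ * X).trace = (X * Aᵀ).trace := trace_mul_comm _ _
    _ = (Xᵀ * Aᵀ).trace := by rw [hX]
    _ = ((A * X)ᵀ).trace := by rw [transpose_mul]
    _ = (A * X).trace := trace_transpose _

/-- Completely positive matrices are symmetric (`CP_k^* ⊆ S^k_+`). [cite: Averkov2019, §2.1 (p06)] -/
theorem transpose_eq_of_mem_completelyPositiveCone {P : Matrix (Fin k) (Fin k) ℝ}
    (hP : P ∈ completelyPositiveCone k) : Pᵀ = P := by
  have h := (posSemidef_of_mem_completelyPositiveCone hP).1
  rwa [IsHermitian, conjTranspose_eq_transpose_of_trivial] at h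

/-! ### §2 Coordinates of `S^k`: `CP_k` becomes the full-dimensional pointed cone `copVec k ⊆ ℝ^{C(k+1,2)}` -/

/-- The tree's coordinate map `vecOfSym : S^k → ℝ^{C(k+1,2)}` (`A ↦ (A_ss, √2 A_st)`), bundled as a linear map
on all of `ℝ^{k×k}` (it reads the upper triangle). [cite: GouveiaRobinsonThomas2015, §4 (p09, "a natural
bijection between `S^k` and `ℝ^d` … preserves the inner product")] -/
def vecOfSymₗ (k : ℕ) : Matrix (Fin k) (Fin k) ℝ →ₗ[ℝ] (SymIdx k → ℝ) where
  toFun := vecOfSym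
  map_add' A B := by
    funext q
    simp only [vecOfSym, Matrix.add_apply, Pi.add_apply]
    split_ifs <;> ring
  map_smul' c A := by
    funext q
    simp only [vecOfSym, Matrix.smul_apply, Pi.smul_apply, smul_eq_mul, RingHom.id_apply]
    split_ifs <;> ring

/-- `vecOfSymₗ` is `vecOfSym`. [cite: GouveiaRobinsonThomas2015, §4 (p09)] -/
@[simp] theorem vecOfSymₗ_apply (A : Matrix (Fin k) (Fin k) ℝ) : vecOfSymₗ k A = vecOfSym A := rfl

/-- **`CP_k` in coordinates**: `copVec k = {z : symOfVec z is copositive} ⊆ ℝ^{C(k+1,2)}`.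
[cite: Averkov2019, §2.1 (p06) and Remark 20 (p08, "passing to appropriate coordinates")] -/
def copVec (k : ℕ) : Set (SymIdx k → ℝ) := {z | IsCopositive (symOfVec z)}

/-- Membership in `copVec`. [cite: Averkov2019, §2.1 (p06)] -/
theorem mem_copVec_iff {z : SymIdx k → ℝ} : z ∈ copVec k ↔ IsCopositive (symOfVec z) := Iff.rfl

/-- `CP_k = symOfVec(copVec k)`. [cite: Averkov2019, Remark 20 (p08)] -/
theorem symCopositiveCone_eq_image : symCopositiveCone k = symOfVec '' copVec k := by
  ext A
  constructor
  · rintro ⟨hA, hAt⟩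
    exact ⟨vecOfSym A, show IsCopositive (symOfVec (vecOfSym A)) by rwa [symOfVec_vecOfSym hAt],
      symOfVec_vecOfSym hAt⟩
  · rintro ⟨z, hz, rfl⟩
    exact ⟨hz, symOfVec_transpose z⟩

/-- `copVec k = vecOfSym(CP_k)`. [cite: Averkov2019, Remark 20 (p08)] -/
theorem copVec_eq_image : copVec k = vecOfSymₗ k '' symCopositiveCone k := by
  ext z
  constructor
  · intro hz
    exact ⟨symOfVec z, ⟨hz, symOfVec_transpose z⟩, by rw [vecOfSymₗ_apply, vecOfSym_symOfVec]⟩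
  · rintro ⟨A, ⟨hA, hAt⟩, rfl⟩
    show IsCopositive (symOfVec (vecOfSym A))
    rwa [symOfVec_vecOfSym hAt]

/-- Lifts of `CP_k` and of its coordinate image correspond, same `d` and `r` (linear images both ways).
[cite: Averkov2019, Remark 20 (p08, "`C` has a `K`-lift if and only if `C_0` has a `K`-lift")] -/
theorem hasBlockPsdLift_symCopositiveCone_iff_copVec {d r : ℕ} :
    HasBlockPsdLift (symCopositiveCone k) d r ↔ HasBlockPsdLift (copVec k) d r := by
  constructor
  · intro h
    rw [copVec_eq_image]
    exact h.image _
  · intro h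
    rw [symCopositiveCone_eq_image]
    exact h.image _

/-! ### §3 The dual of `copVec k` is `CP_k^*` in coordinates (trace duality `CP_k^* = (CP_k)^*`) -/

/-- `vecOfSym P ∈ (copVec k)^*` for completely positive `P`: `⟨z, vecOfSym P⟩ = tr(symOfVec(z) P) =
Σ (symOfVec z)_ij P_ij ≥ 0`. [cite: Averkov2019, §2.1 (p06, "its dual cone `CP_k^*`")] -/
theorem vecOfSym_mem_dualCone {P : Matrix (Fin k) (Fin k) ℝ} (hP : P ∈ completelyPositiveCone k) :
    vecOfSym P ∈ dualCone (copVec k) := by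
  intro z hz
  have hPt := transpose_eq_of_mem_completelyPositiveCone hP
  have h1 : z ⬝ᵥ vecOfSym P = ∑ i, ∑ j, symOfVec z i j * P i j := by
    rw [sum_sum_mul_eq_trace hPt, trace_mul_eq_dotProduct_vecOfSym (symOfVec_transpose z) hPt,
      vecOfSym_symOfVec]
  rw [h1]
  exact (mem_copositiveCone_iff_forall_completelyPositiveCone _).1 hz P hP

/-- `symOfVec y ∈ CP_k^*` for `y ∈ (copVec k)^*`: for copositive `A` (symmetric or not),
`Σ A_ij (symOfVec y)_ij = tr(A · symOfVec y) = ½ ⟨vecOfSym(A + Aᵀ), y⟩ ≥ 0` since `A + Aᵀ ∈ CP_k`; conclude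
by the tree's `CP_k^* = (CP_k)^*`. [cite: Averkov2019, §2.1 (p06)] -/
theorem symOfVec_mem_completelyPositiveCone {y : SymIdx k → ℝ} (hy : y ∈ dualCone (copVec k)) :
    symOfVec y ∈ completelyPositiveCone k := by
  rw [mem_completelyPositiveCone_iff_forall_copositiveCone]
  intro A hA
  have hPt : (symOfVec y)ᵀ = symOfVec y := symOfVec_transpose y
  have hSt : (A + Aᵀ)ᵀ = A + Aᵀ := by rw [transpose_add, transpose_transpose, add_comm]
  have h1 : ∑ i, ∑ j, A i j * symOfVec y i j = (1 / 2) * (vecOfSym (A + Aᵀ) ⬝ᵥ y) := by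
    rw [sum_sum_mul_eq_trace hPt]
    conv_rhs => rw [← vecOfSym_symOfVec y]
    rw [← trace_mul_eq_dotProduct_vecOfSym hSt hPt, Matrix.add_mul, trace_add,
      trace_transpose_mul_of_symm A hPt]
    ring
  rw [h1]
  have h2 : 0 ≤ vecOfSym (A + Aᵀ) ⬝ᵥ y := hy _ (show IsCopositive (symOfVec (vecOfSym (A + Aᵀ))) by
    rw [symOfVec_vecOfSym hSt]
    exact isCopositive_add_transpose hA)
  positivity

/-- **`(copVec k)^* = vecOfSym(CP_k^*)`**. [cite: Averkov2019, §2.1 (p06) and Remark 20 (p08, `C^* = C_0^* × …`)] -/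
theorem dualCone_copVec_eq : dualCone (copVec k) = vecOfSymₗ k '' completelyPositiveCone k := by
  ext y
  constructor
  · intro hy
    exact ⟨symOfVec y, symOfVec_mem_completelyPositiveCone hy, by rw [vecOfSymₗ_apply, vecOfSym_symOfVec]⟩
  · rintro ⟨P, hP, rfl⟩
    exact vecOfSym_mem_dualCone hP

/-- **`CP_k^* = symOfVec((copVec k)^*)`**. [cite: Averkov2019, §2.1 (p06) and Remark 20 (p08)] -/
theorem completelyPositiveCone_eq_image_dualCone :
    completelyPositiveCone k = symOfVec '' dualCone (copVec k) := by
  ext P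
  constructor
  · intro hP
    exact ⟨vecOfSym P, vecOfSym_mem_dualCone hP,
      symOfVec_vecOfSym (transpose_eq_of_mem_completelyPositiveCone hP)⟩
  · rintro ⟨y, hy, rfl⟩
    exact symOfVec_mem_completelyPositiveCone hy

/-! ### §4 `copVec k` is a closed convex pointed full-dimensional cone -/

/-- `copVec k` is convex. [cite: Averkov2019, §2.1 (p06, "closed convex cone")] -/
theorem convex_copVec : Convex ℝ (copVec k) := by
  intro z hz w hw a b ha hb _ x hx
  rw [map_add, map_smul, map_smul, add_mulVec, smul_mulVec, smul_mulVec, dotProduct_add,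
    dotProduct_smul, dotProduct_smul, smul_eq_mul, smul_eq_mul]
  exact add_nonneg (mul_nonneg ha (hz x hx)) (mul_nonneg hb (hw x hx))

/-- `copVec k` is closed. [cite: Averkov2019, §2.1 (p06, "closed convex cone")] -/
theorem isClosed_copVec : IsClosed (copVec k) := by
  have hc : Continuous (symOfVec : (SymIdx k → ℝ) → Matrix (Fin k) (Fin k) ℝ) :=
    LinearMap.continuous_of_finiteDimensional _
  have hset : copVec k = ⋂ x : {x : Fin k → ℝ // ∀ i, 0 ≤ x i}, {z | 0 ≤ x.1 ⬝ᵥ symOfVec z *ᵥ x.1} := by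
    ext z
    simp only [Set.mem_iInter, Set.mem_setOf_eq, mem_copVec_iff, IsCopositive]
    exact ⟨fun h x => h x.1 x.2, fun h x hx => h ⟨x, hx⟩⟩
  rw [hset]
  exact isClosed_iInter fun x =>
    isClosed_le continuous_const (continuous_const.dotProduct (hc.matrix_mulVec continuous_const))

/-- `copVec k` is closed under nonnegative scaling. [cite: Averkov2019, §2.1 (p06, "cone")] -/
theorem smul_mem_copVec {z : SymIdx k → ℝ} (hz : z ∈ copVec k) {t : ℝ} (ht : 0 ≤ t) : t • z ∈ copVec k :=
  fun x hx => by
  rw [map_smul, smul_mulVec, dotProduct_smul, smul_eq_mul]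
  exact mul_nonneg ht (hz x hx)

/-- The all-ones matrix `J`. [folklore] -/
def allOnes (k : ℕ) : Matrix (Fin k) (Fin k) ℝ := Matrix.of fun _ _ => 1

/-- The pointing functional `I + J` in coordinates: `⟨vecOfSym(I + J), z⟩ = tr A + 𝟙ᵀA𝟙`, `A = symOfVec z`.
[cite: Averkov2019, §3.2 (p08, "`C` pointed … `u`")] -/
theorem pointing_apply (z : SymIdx k → ℝ) :
    vecOfSym (1 + allOnes k) ⬝ᵥ z = ∑ i, symOfVec z i i + ∑ i, ∑ j, symOfVec z i j := by
  have hJt : (1 + allOnes k)ᵀ = 1 + allOnes k := by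
    rw [transpose_add, transpose_one]
    rfl
  conv_lhs => rw [← vecOfSym_symOfVec z]
  rw [← trace_mul_eq_dotProduct_vecOfSym hJt (symOfVec_transpose z), Matrix.add_mul, Matrix.one_mul,
    trace_add]
  congr 1
  simp only [trace, diag_apply, mul_apply, allOnes, of_apply, one_mul]
  rw [Finset.sum_comm]

/-- `⟨vecOfSym(I + J), z⟩ ≥ 0` on `copVec k` (diagonal entries and `𝟙ᵀA𝟙` are `≥ 0`).
[cite: Averkov2019, §3.2 (p08)] -/
theorem pointing_nonneg {z : SymIdx k → ℝ} (hz : z ∈ copVec k) : 0 ≤ vecOfSym (1 + allOnes k) ⬝ᵥ z := by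
  rw [pointing_apply]
  refine add_nonneg (sum_nonneg fun i _ => diag_nonneg_of_isCopositive hz i) ?_
  rw [← qf_ones]
  exact hz _ fun _ => zero_le_one

/-- **`copVec k` is pointed**: `tr A + 𝟙ᵀA𝟙 = 0` forces a symmetric copositive `A` to be `0` (zero diagonal,
then `A_ij ≥ 0` from `e_i + e_j`, then `Σ A_ij = 0`). [cite: Averkov2019, §3.2 (p08, "`C` is pointed")] -/
theorem eq_zero_of_pointing_eq_zero {z : SymIdx k → ℝ} (hz : z ∈ copVec k)
    (h0 : vecOfSym (1 + allOnes k) ⬝ᵥ z = 0) : z = 0 := by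
  rw [pointing_apply] at h0
  have hzc : IsCopositive (symOfVec z) := hz
  set A := symOfVec z with hA
  have hdiag : ∀ i, 0 ≤ A i i := diag_nonneg_of_isCopositive hzc
  have htot : 0 ≤ ∑ i, ∑ j, A i j := by
    rw [← qf_ones]
    exact hzc _ fun _ => zero_le_one
  have hdsum : 0 ≤ ∑ i, A i i := sum_nonneg fun i _ => hdiag i
  have h1 : ∑ i, A i i = 0 := by linarith
  have h2 : ∑ i, ∑ j, A i j = 0 := by linarith
  have hdiag0 : ∀ i, A i i = 0 := fun i => (sum_eq_zero_iff_of_nonneg fun i _ => hdiag i).1 h1 i (mem_univ i)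
  have hall : ∀ i j, 0 ≤ A i j := fun i j =>
    offdiag_nonneg_of_isCopositive hzc (symOfVec_transpose z) (hdiag0 i) (hdiag0 j)
  have hrow : ∀ i, ∑ j, A i j = 0 := fun i =>
    (sum_eq_zero_iff_of_nonneg fun i _ => sum_nonneg fun j _ => hall i j).1 h2 i (mem_univ i)
  have hall0 : ∀ i j, A i j = 0 := fun i j => (sum_eq_zero_iff_of_nonneg fun j _ => hall i j).1 (hrow i) j (mem_univ j)
  have hA0 : A = 0 := by
    ext i j
    exact hall0 i j
  rw [← vecOfSym_symOfVec z, ← hA, hA0]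
  exact map_zero (vecOfSymₗ k)

/-- `copVec k` is pointed by `vecOfSym(I + J)`. [cite: Averkov2019, §3.2 (p08)] -/
theorem copVec_pointed : ∃ u : SymIdx k → ℝ, (∀ z ∈ copVec k, 0 ≤ u ⬝ᵥ z) ∧ ∀ z ∈ copVec k, u ⬝ᵥ z = 0 → z = 0 :=
  ⟨vecOfSym (1 + allOnes k), fun _ hz => pointing_nonneg hz, fun _ hz h0 => eq_zero_of_pointing_eq_zero hz h0⟩

/-- Entries of `symOfVec w` are bounded by the sup norm of `w` (the off-diagonal ones carry `1/√2 ≤ 1`).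
[cite: GouveiaRobinsonThomas2015, §4 (p09)] -/
theorem abs_symOfVec_apply_le (w : SymIdx k → ℝ) (i j : Fin k) : |symOfVec w i j| ≤ ‖w‖ := by
  rw [symOfVec_apply]
  have h1 : |w (symIdxOf i j)| ≤ ‖w‖ := by
    rw [← Real.norm_eq_abs]
    exact norm_le_pi_norm w _
  have hs : (1 : ℝ) ≤ Real.sqrt 2 := by
    have h := Real.sqrt_le_sqrt (show (1 : ℝ) ≤ 2 by norm_num)
    rwa [Real.sqrt_one] at h
  split_ifs
  · exact h1
  · rw [abs_div, abs_of_pos (lt_of_lt_of_le one_pos hs)]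
    exact (div_le_self (abs_nonneg _) hs).trans h1

/-- **`copVec k` is full-dimensional**: `vecOfSym I` is an interior point — if `‖z - vecOfSym I‖_∞ < ε = 1/(k+1)`
then `symOfVec z = I + E` with `|E_ij| < ε`, and for `x ≥ 0`, `xᵀ(I + E)x ≥ ‖x‖² - ε(Σ x_i)² ≥ (1 - kε)‖x‖² ≥ 0`.
[cite: Averkov2019, §2.1 (p06, "`n`-dimensional") and Remark 20 (p08)] -/
theorem vecOfSym_one_mem_interior : vecOfSym (1 : Matrix (Fin k) (Fin k) ℝ) ∈ interior (copVec k) := by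
  rw [mem_interior_iff_mem_nhds, Metric.mem_nhds_iff]
  refine ⟨1 / (k + 1), by positivity, fun z hz => ?_⟩
  rw [Metric.mem_ball, dist_eq_norm] at hz
  set ε : ℝ := 1 / (k + 1) with hε
  have hεpos : 0 < ε := by positivity
  have hεk : ε * k ≤ 1 := by
    rw [hε, div_mul_eq_mul_div, one_mul]
    exact div_le_one_of_le₀ (by linarith) (by positivity)
  have hE : ∀ i j, -ε ≤ (symOfVec z - 1) i j := by
    intro i j
    have h1 : symOfVec z - 1 = symOfVec (z - vecOfSym 1) := by
      rw [map_sub, symOfVec_vecOfSym transpose_one]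
    rw [h1]
    exact (abs_le.1 ((abs_symOfVec_apply_le (z - vecOfSym 1) i j).trans hz.le)).1
  intro x hx
  have hsplit : x ⬝ᵥ symOfVec z *ᵥ x = x ⬝ᵥ x + x ⬝ᵥ (symOfVec z - 1) *ᵥ x := by
    rw [sub_mulVec, one_mulVec, dotProduct_sub]
    ring
  rw [hsplit]
  have hq : -ε * (∑ i, x i) ^ 2 ≤ x ⬝ᵥ (symOfVec z - 1) *ᵥ x := by
    simp only [dotProduct, mulVec, Finset.mul_sum]
    rw [sq, Finset.sum_mul_sum, Finset.mul_sum]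
    refine Finset.sum_le_sum fun i _ => ?_
    rw [Finset.mul_sum]
    refine Finset.sum_le_sum fun j _ => ?_
    have h := mul_le_mul_of_nonneg_right (hE i j) (mul_nonneg (hx i) (hx j))
    calc -ε * (x i * x j) ≤ (symOfVec z - 1) i j * (x i * x j) := h
      _ = x i * ((symOfVec z - 1) i j * x j) := by ring
  have hcs : (∑ i, x i) ^ 2 ≤ k * ∑ i, x i ^ 2 := by
    have h := sq_sum_le_card_mul_sum_sq (s := (univ : Finset (Fin k))) (f := x)
    simpa [Finset.card_univ, Fintype.card_fin] using h
  have hxx : x ⬝ᵥ x = ∑ i, x i ^ 2 := by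
    simp [dotProduct, sq]
  have hS : 0 ≤ ∑ i, x i ^ 2 := sum_nonneg fun i _ => sq_nonneg _
  rw [hxx]
  nlinarith [mul_le_mul_of_nonneg_left hcs hεpos.le, mul_le_mul_of_nonneg_right hεk hS]

/-! ### §5 Assembly: (2.1)/(2.2) for `CP_k` -/

/-- Lifts of `copVec k` ⟺ lifts of `CP_k^*`, same `d`, `r`: the tree's `hasBlockPsdLift_dualCone_iff` ((2.1)/(2.2)
for pointed full-dimensional closed convex cones) applied to `copVec k`, and `(copVec k)^* ≅ CP_k^*` (§3).
[cite: Averkov2019, (2.1)–(2.2) (p06) and Remark 21 (p08)] -/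
theorem hasBlockPsdLift_copVec_iff {d r : ℕ} :
    HasBlockPsdLift (copVec k) d r ↔ HasBlockPsdLift (completelyPositiveCone k) d r := by
  rw [← hasBlockPsdLift_dualCone_iff convex_copVec isClosed_copVec (fun z hz t ht => smul_mem_copVec hz ht)
    copVec_pointed ⟨_, vecOfSym_one_mem_interior⟩]
  constructor
  · intro h
    rw [completelyPositiveCone_eq_image_dualCone]
    exact h.image _
  · intro h
    rw [dualCone_copVec_eq]
    exact h.image _

end CopositiveDual

open CopositiveDual

/-- **Averkov 2019, (2.1) and (2.2) for `C = CP_k`**: the symmetric copositive cone `CP_k` has an `(S^d_+)^r`-lift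
iff the completely positive cone `CP_k^*` has one — the SAME `d` and `r`; in particular `sxc(CP_k) = sxc(CP_k^*)`
(`r = 1`) and `sxd(CP_k) = sxd(CP_k^*)`. [cite: Averkov2019, (2.1)–(2.2) (p06) and Cor. 16 (p06)] -/
theorem hasBlockPsdLift_symCopositiveCone_iff {k d r : ℕ} :
    HasBlockPsdLift (symCopositiveCone k) d r ↔ HasBlockPsdLift (completelyPositiveCone k) d r :=
  hasBlockPsdLift_symCopositiveCone_iff_copVec.trans hasBlockPsdLift_copVec_iff

/-- A lift of the tree's (non-symmetric) `copositiveCone k` restricts to one of `CP_k ⊆ S^k` (section by the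
symmetric matrices). [cite: Averkov2019, §2.1 (p06)] [cite: GouveiaParriloThomas2013, Def. 2.2 (§2)] -/
theorem HasBlockPsdLift.symCopositiveCone_of_copositiveCone {k d r : ℕ} (h : HasBlockPsdLift (copositiveCone k) d r) :
    HasBlockPsdLift (symCopositiveCone k) d r :=
  h.inter_affineSubspace (symmetricSubmodule (Fin k) ℝ).toAffineSubspace

/-- `xᵀNx ≥ 0` for `x ≥ 0` and `N` with `N_ij + N_ji ≥ 0` (`2xᵀNx = xᵀ(N + Nᵀ)x`).
[cite: Averkov2019, proof of Cor. 16 (p13, `N^k_+`)] -/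
theorem isCopositive_of_mem_symNonnegCone {k : ℕ} {N : Matrix (Fin k) (Fin k) ℝ} (hN : N ∈ symNonnegCone k) :
    IsCopositive N := fun x hx => by
  have h2 : 2 * (x ⬝ᵥ N *ᵥ x) = x ⬝ᵥ (N + Nᵀ) *ᵥ x := by
    rw [add_mulVec, dotProduct_add, qf_transpose]
    ring
  have h3 : 0 ≤ x ⬝ᵥ (N + Nᵀ) *ᵥ x := by
    simp only [dotProduct, mulVec, Finset.mul_sum]
    exact sum_nonneg fun i _ => sum_nonneg fun j _ =>
      mul_nonneg (hx i) (mul_nonneg (by simpa [Matrix.add_apply, transpose_apply] using hN i j) (hx j))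
  linarith

/-- **`copositiveCone k = CP_k + N^k_+`**: a matrix is copositive iff its symmetric part is, and the tree's
`symNonnegCone k = {N : N_ij + N_ji ≥ 0}` contains all skew-symmetric matrices (`A = ½(A + Aᵀ) + ½(A - Aᵀ)`).
[cite: Averkov2019, §2.1 (p06, `CP_k ⊆ S^k`) and proof of Cor. 16 (p13, `N^k_+`)] -/
theorem copositiveCone_eq_symCopositiveCone_add_symNonnegCone (k : ℕ) :
    copositiveCone k = symCopositiveCone k + symNonnegCone k := by
  ext A
  constructor
  · intro hA
    refine Set.mem_add.2 ⟨(1 / 2 : ℝ) • (A + Aᵀ), ⟨?_, ?_⟩, (1 / 2 : ℝ) • (A - Aᵀ), ?_, ?_⟩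
    · intro x hx
      rw [smul_mulVec, dotProduct_smul, smul_eq_mul]
      exact mul_nonneg (by norm_num) (isCopositive_add_transpose hA x hx)
    · show ((1 / 2 : ℝ) • (A + Aᵀ))ᵀ = (1 / 2 : ℝ) • (A + Aᵀ)
      rw [transpose_smul, transpose_add, transpose_transpose, add_comm]
    · intro i j
      simp only [Matrix.smul_apply, Matrix.sub_apply, transpose_apply, smul_eq_mul]
      linarith
    · ext i j
      simp only [Matrix.add_apply, Matrix.smul_apply, Matrix.sub_apply, transpose_apply, smul_eq_mul]
      ring
  · rintro ⟨S, ⟨hS, -⟩, N, hN, rfl⟩ x hx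
    rw [add_mulVec, dotProduct_add]
    exact add_nonneg (hS x hx) (isCopositive_of_mem_symNonnegCone hN x hx)

/-- Back from `CP_k` to the tree's `copositiveCone k`: add the tree's `(S^k_+)^{2k}`-lift of `N^k_+`
(`hasBlockPsdLift_symNonnegCone`), with blocks enlarged to `d ≥ k`. [cite: Averkov2019, Lemma 31 (p12, sums)
and proof of Cor. 16 (p13)] -/
theorem HasBlockPsdLift.copositiveCone_of_symCopositiveCone {k d r : ℕ} (h : HasBlockPsdLift (symCopositiveCone k) d r)
    (hkd : k ≤ d) : HasBlockPsdLift (copositiveCone k) d (r + (k + k)) := by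
  rw [copositiveCone_eq_symCopositiveCone_add_symNonnegCone]
  exact h.add ((hasBlockPsdLift_symNonnegCone k).mono_size hkd)

/-- **`CP_k` lift ⇒ `CP_k^*` lift, same cone `(S^d_+)^r`** (for the tree's `copositiveCone`).
[cite: Averkov2019, (2.2) (p06) and Cor. 16 (p06)] -/
theorem HasBlockPsdLift.completelyPositiveCone_of_copositiveCone {k d r : ℕ}
    (h : HasBlockPsdLift (copositiveCone k) d r) : HasBlockPsdLift (completelyPositiveCone k) d r :=
  hasBlockPsdLift_symCopositiveCone_iff.1 h.symCopositiveCone_of_copositiveCone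

/-- **`CP_k^*` lift ⇒ `CP_k` lift with the same block size** (`2k` more blocks for the skew part of the tree's
non-symmetric `copositiveCone`; `k ≤ d` is automatic, `le_of_hasBlockPsdLift_completelyPositiveCone`).
[cite: Averkov2019, (2.2) (p06) and Cor. 16 (p06)] -/
theorem HasBlockPsdLift.copositiveCone_of_completelyPositiveCone {k d r : ℕ}
    (h : HasBlockPsdLift (completelyPositiveCone k) d r) : HasBlockPsdLift (copositiveCone k) d (r + (k + k)) :=
  (hasBlockPsdLift_symCopositiveCone_iff.2 h).copositiveCone_of_symCopositiveCone
    (le_of_hasBlockPsdLift_completelyPositiveCone h)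

/-- The feasible block sizes of `copositiveCone k` and of `completelyPositiveCone k` coincide.
[cite: Averkov2019, Cor. 16 (p06, "`sxd(CP_k) = sxd(CP_k^*)`")] -/
theorem setOf_blockSize_copositiveCone_eq (k : ℕ) :
    {K | ∃ m, HasBlockPsdLift (copositiveCone k) K m} = {K | ∃ m, HasBlockPsdLift (completelyPositiveCone k) K m} := by
  ext K
  exact ⟨fun ⟨m, h⟩ => ⟨m, h.completelyPositiveCone_of_copositiveCone⟩,
    fun ⟨_, h⟩ => ⟨_, h.copositiveCone_of_completelyPositiveCone⟩⟩

/-- The feasible block sizes of Averkov's symmetric `CP_k` and of `CP_k^*` coincide (here even with the same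
number of blocks). [cite: Averkov2019, Cor. 16 (p06)] -/
theorem setOf_blockSize_symCopositiveCone_eq (k : ℕ) :
    {K | ∃ m, HasBlockPsdLift (symCopositiveCone k) K m} =
      {K | ∃ m, HasBlockPsdLift (completelyPositiveCone k) K m} := by
  ext K
  exact ⟨fun ⟨m, h⟩ => ⟨m, hasBlockPsdLift_symCopositiveCone_iff.1 h⟩,
    fun ⟨m, h⟩ => ⟨m, hasBlockPsdLift_symCopositiveCone_iff.2 h⟩⟩

/-- **Averkov 2019, Cor. 16, first clause: `sxd(CP_k) = sxd(CP_k^*)`** for every `k` — `K₀` is the least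
feasible block size of the copositive cone iff it is the least feasible block size of the completely positive
cone (the tree states `sxd` values as `IsLeast {K | ∃ m, HasBlockPsdLift C K m} K₀`). With the tree's
`mem_lowerBounds_blockSize_hasBlockPsdLift_copositiveCone` (`≥ k`) and `…_of_le_four` (`= k`, `k ≤ 4`) this is
all of Cor. 16; "the exact values `sxd(CP_k)` for `k > 4` are left undetermined" (p06).
[cite: Averkov2019, Cor. 16 (p06)] -/
theorem Averkov2019_cor16_sxd (k K₀ : ℕ) :
    IsLeast {K | ∃ m, HasBlockPsdLift (copositiveCone k) K m} K₀ ↔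
      IsLeast {K | ∃ m, HasBlockPsdLift (completelyPositiveCone k) K m} K₀ := by
  rw [setOf_blockSize_copositiveCone_eq]

/-- "It is not even known if these values are finite" (p06): after this file the two questions are one —
`CP_k` has a semidefinite extended formulation iff `CP_k^*` has one. [cite: Averkov2019, Cor. 16 and the
sentence after it (p06)] -/
theorem exists_hasBlockPsdLift_copositiveCone_iff (k : ℕ) :
    (∃ K m, HasBlockPsdLift (copositiveCone k) K m) ↔ ∃ K m, HasBlockPsdLift (completelyPositiveCone k) K m :=
  ⟨fun ⟨K, m, h⟩ => ⟨K, m, h.completelyPositiveCone_of_copositiveCone⟩,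
    fun ⟨K, _, h⟩ => ⟨K, _, h.copositiveCone_of_completelyPositiveCone⟩⟩

end Literature.Combinatorics.Optimization
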